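import Literature.RepresentationTheory.HeisenbergGroup.LatticeModelIrreducible
import Literature.RepresentationTheory.HeisenbergGroup.LatticeModelContinuous
import Literature.RepresentationTheory.HeisenbergGroup.DualLatticePair
import HarnessLib

/-!
# Existence of the irreducible unitary `ψ`-representation of a lattice-pair Heisenberg group

Topic `RepresentationTheory/HeisenbergGroup`; namespace `Literature.RepresentationTheory.HeisenbergGroup.LatticeModel`.
KERNEL ONLY: theorems; no definition, no named fact, no `sorry`.

The scalar case `E = ℂ` of `LatticeModel` / `LatticeModelIrreducible` / `LatticeModelContinuous`: for a dual lattice pair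
`(B₁, B₂)` (`IsDualLatticePair β ψ B₁ B₂` of `DualLatticePair.lean` — every finite place `(𝒪_vⁿ, 𝔠_vⁿ)` and the
finite adeles `((∏𝒪_v)ⁿ, (∏𝔠_v)ⁿ)`), a continuous `ψ` and a jointly continuous pairing `β`, the lattice model
`Ind_A^H ψ_A` on `ℓ²(A\H)` is a representation of `H = Heisenberg (polar β)` on a Hilbert space `≠ 0` by isometries,
with continuous orbit maps, central character `ψ`, and no closed invariant subspace other than `⊥`, `⊤`
(**`exists_irreducible_unitary_rep`**) — the EXISTENCE counterpart of the tree's model-free uniqueness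
`StoneVonNeumannLatticePair.exists_linearIsometryEquiv_of_irreducible_of_isDualLatticePair`
(MVW, Chap. 2, I.3, II.8; Weil 1964 n° 12–13; [GelbartRogawski1991, §3.1 p. 454 L19–21] at the finite places).

## References
* [MoeglinVignerasWaldspurger1987] C. Mœglin, M.-F. Vignéras, J.-L. Waldspurger, LNM 1291 (1987), Chap. 2, I.3, II.8.
* [Weil1964] A. Weil, Acta Math. 111 (1964), Chap. I n° 12–13.
* [GelbartRogawski1991] S. Gelbart, J. Rogawski, Invent. Math. 105 (1991), §3.1 p. 454 L19–21.
-/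

set_option autoImplicit false

noncomputable section

open Filter Topology

namespace Literature.RepresentationTheory.HeisenbergGroup

namespace LatticeModel

universe u

variable {Rf : Type u} [CommRing Rf] [TopologicalSpace Rf] [IsTopologicalAddGroup Rf]
  {Xf Yf : Type u} [AddCommGroup Xf] [Module Rf Xf] [AddCommGroup Yf] [Module Rf Yf]
  [TopologicalSpace Xf] [IsTopologicalAddGroup Xf] [TopologicalSpace Yf] [IsTopologicalAddGroup Yf]
  (β : Xf →ₗ[Rf] Yf →ₗ[Rf] Rf) (ψ : AddChar Rf Circle) {B₁ : AddSubgroup Xf} {B₂ : AddSubgroup Yf}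

/-- **Existence of the irreducible unitary `ψ`-representation of `Heisenberg (polar β)`** for a dual lattice pair
`(B₁, B₂)`: the scalar lattice model `ℓ²((X × Y)/(B₁ × B₂))` is a Hilbert space `≠ 0` on which `H` acts by
isometries with continuous orbit maps `w ↦ τ (w, 0) f`, central character `ψ`, and no closed invariant subspace
other than `⊥`, `⊤`. [cite: MoeglinVignerasWaldspurger1987, Chap. 2 I.3, II.8] -/
theorem exists_irreducible_unitary_rep (hB : IsDualLatticePair β ψ B₁ B₂) (hψc : Continuous ψ)
    (hβc : Continuous fun p : Xf × Yf => β p.1 p.2) :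
    ∃ (S : Type u) (_ : NormedAddCommGroup S) (_ : InnerProductSpace ℂ S) (_ : CompleteSpace S) (_ : Nontrivial S)
      (τ : Representation ℂ (Heisenberg (polar β)) S),
      (∀ (h : Heisenberg (polar β)) (f : S), ‖τ h f‖ = ‖f‖) ∧
      (∀ f : S, Continuous fun w : Xf × Yf => τ ⟨w, 0⟩ f) ∧
      (∀ (t : Rf) (f : S), τ (Heisenberg.ofCenter (polar β) (Multiplicative.ofAdd t)) f = ((ψ t : Circle) : ℂ) • f) ∧
      ∀ K : Submodule ℂ S, IsClosed (K : Set S) →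
        (∀ (h : Heisenberg (polar β)), ∀ f ∈ K, τ h f ∈ K) → K = ⊥ ∨ K = ⊤ := by
  classical
  have hψB : ∀ x ∈ B₁, ∀ y ∈ B₂, ψ (β x y) = 1 := fun x hx y hy => hB.apply_eq_one hx hy
  -- the trivial coefficient representation of the trivial group on `ℂ`
  let π : Representation ℂ Unit ℂ := 1
  have hπu : ∀ (g : Unit) (v : ℂ), ‖π g v‖ = ‖v‖ := fun g v => by
    rw [map_one]
    rfl
  have hπ' : ∀ T : ℂ →L[ℂ] ℂ, (∀ (g : Unit) (v : ℂ), T (π g v) = π g (T v)) → ∃ c : ℂ, ∀ v, T v = c • v :=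
    fun T _ => ⟨T 1, fun v => by rw [smul_eq_mul, mul_comm, ← smul_eq_mul, ← map_smul, smul_eq_mul, mul_one]⟩
  refine ⟨lp (fun _ : (Xf × Yf) ⧸ B₁.prod B₂ => ℂ) 2, inferInstance, inferInstance, inferInstance, ?_,
    rep β ψ B₁ B₂ ℂ hψB, fun h f => norm_rep_apply β ψ B₁ B₂ ℂ hψB h f,
    fun f => continuous_rep_mk_zero β ψ B₁ B₂ ℂ hψB hB.isOpen_left hB.isOpen_right hψc hβc f,
    fun t f => rep_ofCenter β ψ B₁ B₂ ℂ hψB t f, fun K hKc hK => ?_⟩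
  · refine ⟨⟨lp.single 2 (0 : (Xf × Yf) ⧸ B₁.prod B₂) (1 : ℂ), 0, fun h0 => one_ne_zero (α := ℂ) ?_⟩⟩
    have := congrArg (fun G : lp (fun _ : (Xf × Yf) ⧸ B₁.prod B₂ => ℂ) 2 => G 0) h0
    simpa only [lp.single_apply, Pi.single_eq_same, lp.coeFn_zero, Pi.zero_apply] using this
  · refine irreducible β ψ B₁ B₂ ℂ hψB π hπu (fun x hx => hB.exists_right_ne_one hx)
      (fun y hy => hB.exists_left_ne_one hy) hπ' K hKc hK fun g F hF => ?_
    -- the trivial coefficient action fixes every vector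
    have : coeff B₁ B₂ ℂ π hπu g F = F := by
      apply lp.ext
      funext q
      rw [coeff_apply, map_one]
      rfl
    rw [this]
    exact hF

end LatticeModel

end Literature.RepresentationTheory.HeisenbergGroup

end
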